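import Literature.NumberTheory.Transcendental.KZDilationRationalNormalFormPrep
import Literature.NumberTheory.Transcendental.RationalPartialFractionsEval
import Literature.NumberTheory.Transcendental.KZBallPeelingAux
import Mathlib.FieldTheory.AlgebraicClosure
import Mathlib.Analysis.Complex.Polynomial.Basic
import Mathlib.Analysis.Calculus.Deriv.Polynomial
import HarnessLib

/-!
# Baker normal form of rational one-variable integrands, II: the normal form

**Theorem** (`exists_bakerNormalForm`). Let `P, Q ∈ ℚ[X]` with `Q` non-vanishing on an open interval
`(a,b) ∋ 0`. Then on `(a,b)`
  `P(x)/Q(x) = ρ'(x) + Σ_k (γ_k(−p_k + (p_k²+q_k²)x) + δ_k q_k)/((1 − p_k x)² + (q_k x)²)`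
with `ρ` Nash (`ℚ`-semialgebraic, real-analytic) on `(a,b)`, real ALGEBRAIC `p_k, q_k, γ_k, δ_k`
(`p_k + iq_k = 1/α_k` over the complex roots `α_k` of `Q`, `γ_k + iδ_k` the residues divided by the
leading coefficient) and the slit condition `0 < 1 − p_k x ∨ q_k x ≠ 0` on `(a,b)` — exactly the
hypotheses of the complex Baker sector `KZ.dilationBakerSectorComplex_lift`. Proof: partial fractions
over `ℚ̄ = algebraicClosure ℚ ℂ` (algebraically closed, so roots and residues are algebraic for free;
`exists_partialFraction_map_eval`), real parts: the polynomial part and the higher pole terms have the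
Nash primitive `ρ`, the simple poles give the residue terms (`re_div_sub_eq_residue_term`).

Everything is proved; no `def`, no named fact.

## References
* standard (partial fractions). [folklore]
-/

noncomputable section

open Set Filter Complex Polynomial
open scoped BigOperators Topology Real ComplexConjugate
open Literature.ModelTheory.ExponentialFields

namespace Literature.NumberTheory.Transcendental

namespace KZ.BakerSectorComplex

/-- Real part of the evaluation of a complex polynomial at a real point, as a real polynomial
evaluation: `Re(Σ c_i x^i) = Σ Re(c_i) x^i`. [folklore] -/
theorem re_eval_ofReal (R : ℂ[X]) (x : ℝ) :
    (R.eval (x : ℂ)).re = ∑ i ∈ Finset.range (R.natDegree + 1), (R.coeff i).re * x ^ i := by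
  rw [eval_eq_sum_range, Complex.re_sum]
  refine Finset.sum_congr rfl fun i _ => ?_
  rw [← Complex.ofReal_pow, Complex.re_mul_ofReal]

/-- **Baker normal form of a rational integrand.** See the module docstring. [folklore] -/
theorem exists_bakerNormalForm (P Q : ℚ[X]) {a b : ℝ} (ha : a < 0) (hb : 0 < b)
    (hI : IsSemialgebraic ℚ {t : Fin 1 → ℝ | t 0 ∈ Ioo a b})
    (hQ : ∀ x ∈ Ioo a b, Polynomial.aeval x Q ≠ 0) :
    ∃ (ρ : ℝ → ℝ) (A : ℕ) (p q γ δ : Fin A → ℝ),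
      IsSemialgebraicFunOn ℚ {t : Fin 1 → ℝ | t 0 ∈ Ioo a b} (fun t => ρ (t 0)) ∧
      (∀ x ∈ Ioo a b, AnalyticAt ℝ ρ x) ∧
      (∀ k, IsAlgebraic ℚ (p k)) ∧ (∀ k, IsAlgebraic ℚ (q k)) ∧
      (∀ k, IsAlgebraic ℚ (γ k)) ∧ (∀ k, IsAlgebraic ℚ (δ k)) ∧
      (∀ k, ∀ x ∈ Ioo a b, 0 < 1 - p k * x ∨ q k * x ≠ 0) ∧
      ∀ x ∈ Ioo a b, Polynomial.aeval x P / Polynomial.aeval x Q =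
        deriv ρ x + ∑ k, (γ k * (-p k + (p k ^ 2 + q k ^ 2) * x) + δ k * q k) /
          ((1 - p k * x) ^ 2 + (q k * x) ^ 2) := by
  classical
  have h0I : (0:ℝ) ∈ Ioo a b := ⟨ha, hb⟩
  -- the algebraic closure of `ℚ` in `ℂ`
  haveI hAC : IsAlgClosed (algebraicClosure ℚ ℂ) := (algebraicClosure.isAlgClosure ℚ ℂ).isAlgClosed
  set φ : (algebraicClosure ℚ ℂ) →+* ℂ := algebraMap (algebraicClosure ℚ ℂ) ℂ with hφ
  have hφalg : ∀ z : algebraicClosure ℚ ℂ, IsAlgebraic ℚ (φ z) := fun z =>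
    mem_algebraicClosure_iff.mp z.2
  have hφapply : ∀ z : algebraicClosure ℚ ℂ, φ z = (z : ℂ) := fun z => rfl
  set QL : (algebraicClosure ℚ ℂ)[X] := Q.map (algebraMap ℚ (algebraicClosure ℚ ℂ)) with hQL
  set PL : (algebraicClosure ℚ ℂ)[X] := P.map (algebraMap ℚ (algebraicClosure ℚ ℂ)) with hPL
  have hQ0 : Q ≠ 0 := by
    intro h; exact hQ 0 h0I (by simp [h])
  have hQL0 : QL ≠ 0 := (Polynomial.map_ne_zero_iff (algebraMap ℚ _).injective).mpr hQ0
  -- compatibility of evaluations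
  have hcomp : φ.comp (algebraMap ℚ (algebraicClosure ℚ ℂ)) = algebraMap ℚ ℂ :=
    (IsScalarTower.algebraMap_eq ℚ (algebraicClosure ℚ ℂ) ℂ).symm
  have heval : ∀ (R : ℚ[X]) (x : ℝ),
      ((R.map (algebraMap ℚ (algebraicClosure ℚ ℂ))).map φ).eval (x : ℂ) =
        ((Polynomial.aeval x R : ℝ) : ℂ) := by
    intro R x
    rw [Polynomial.map_map, hcomp, eval_map, ← aeval_def, ← Complex.coe_algebraMap,
      aeval_algebraMap_apply]
  have hlc : φ QL.leadingCoeff = ((Q.leadingCoeff : ℚ) : ℂ) := by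
    rw [hQL, leadingCoeff_map, ← RingHom.comp_apply, hcomp]; simp
  have hlc0 : ((Q.leadingCoeff : ℚ) : ℂ) ≠ 0 := by
    exact_mod_cast leadingCoeff_ne_zero.mpr hQ0
  -- partial fractions over `ℚ̄`, evaluated in `ℂ`
  obtain ⟨quo, c, hpf⟩ := exists_partialFraction_map_eval φ PL QL hQL0
  set s : Finset (algebraicClosure ℚ ℂ) := QL.roots.toFinset with hs
  set n : algebraicClosure ℚ ℂ → ℕ := fun α => QL.rootMultiplicity α with hn
  -- points of `(a,b)` are not roots; roots are non-zero; multiplicities are positive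
  have hQx : ∀ x ∈ Ioo a b, (QL.map φ).eval (x : ℂ) ≠ 0 := by
    intro x hx; rw [heval]; exact_mod_cast hQ x hx
  have hxα : ∀ α ∈ s, ∀ x ∈ Ioo a b, (x : ℂ) ≠ φ α := by
    intro α hα x hx h
    apply hQx x hx
    have hroot : IsRoot QL α := (mem_roots hQL0).mp (Multiset.mem_toFinset.mp hα)
    rw [h, eval_map, eval₂_hom, hroot.eq_zero, map_zero]
  have hα0 : ∀ α ∈ s, φ α ≠ 0 := by
    intro α hα h
    exact hxα α hα 0 h0I (by simpa using h.symm)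
  have hnpos : ∀ α ∈ s, 0 < n α := fun α hα =>
    (rootMultiplicity_pos hQL0).mpr ((mem_roots hQL0).mp (Multiset.mem_toFinset.mp hα))
  -- index the roots by `Fin A`
  set A : ℕ := s.card with hA
  set e : Fin A ≃ s := s.equivFin.symm with he
  set αk : Fin A → ℂ := fun k => φ (e k : algebraicClosure ℚ ℂ) with hαk
  have hαks : ∀ k, ((e k : algebraicClosure ℚ ℂ)) ∈ s := fun k => (e k).2
  have hαk0 : ∀ k, αk k ≠ 0 := fun k => hα0 _ (hαks k)
  have hxαk : ∀ k, ∀ x ∈ Ioo a b, (x : ℂ) ≠ αk k := fun k x hx => hxα _ (hαks k) x hx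
  have hαkalg : ∀ k, IsAlgebraic ℚ (αk k) := fun k => hφalg _
  -- residues (divided by the leading coefficient)
  set d : Fin A → ℂ := fun k => φ (c (e k) (n (e k) - 1)) / ((Q.leadingCoeff : ℚ) : ℂ) with hd
  have hlcalg : IsAlgebraic ℚ (((Q.leadingCoeff : ℚ) : ℂ)⁻¹) := by
    simpa using isAlgebraic_algebraMap (R := ℚ) (A := ℂ) (Q.leadingCoeff⁻¹)
  have hdalg : ∀ k, IsAlgebraic ℚ (d k) := fun k => by
    simp only [hd, div_eq_mul_inv]
    exact (hφalg _).mul hlcalg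
  -- constants of the higher pole terms: `κ_{k,j} = −φ(c_{k,j})/(lc · m)`, `m = N_k − 1 − j ≥ 1`
  set N : Fin A → ℕ := fun k => n (e k) with hN
  have hNpos : ∀ k, 0 < N k := fun k => hnpos _ (hαks k)
  set κ : Fin A → ℕ → ℂ := fun k j =>
    -(φ (c (e k) j)) / (((Q.leadingCoeff : ℚ) : ℂ) * ((N k - 1 - j : ℕ) : ℂ)) with hκ
  have hκalg : ∀ k j, IsAlgebraic ℚ (κ k j) := fun k j => by
    simp only [hκ, div_eq_mul_inv, mul_inv]
    refine ((hφalg _).neg).mul (hlcalg.mul ?_)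
    simpa using isAlgebraic_algebraMap (R := ℚ) (A := ℂ) (((N k - 1 - j : ℕ) : ℚ)⁻¹)
  -- the polynomial part: `r_i = Re(φ(quo_i))/lc`
  set M : ℕ := quo.natDegree + 1 with hM
  set r : ℕ → ℝ := fun i => (φ (quo.coeff i)).re / (Q.leadingCoeff : ℝ) with hr
  have hralg : ∀ i, IsAlgebraic ℚ (r i) := fun i => by
    simp only [hr, div_eq_mul_inv]
    refine (isAlgebraic_re_im (hφalg _)).1.mul ?_
    simpa using isAlgebraic_algebraMap (R := ℚ) (A := ℝ) (Q.leadingCoeff⁻¹)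
  -- the Nash primitive `ρ`
  set ρ : ℝ → ℝ := fun x => (∑ i ∈ Finset.range M, r i / ((i:ℝ) + 1) * x ^ (i + 1)) +
    ∑ k, ∑ j ∈ Finset.range (N k - 1), (κ k j * ((((x : ℂ) - αk k) ^ (N k - 1 - j)))⁻¹).re with hρ
  -- its derivative on `(a,b)`
  have hρd : ∀ x ∈ Ioo a b, HasDerivAt ρ ((∑ i ∈ Finset.range M, r i * x ^ i) +
      ∑ k, ∑ j ∈ Finset.range (N k - 1),
        (-((N k - 1 - j : ℕ) : ℂ) * κ k j * ((((x : ℂ) - αk k) ^ (N k - 1 - j + 1)))⁻¹).re) x := by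
    intro x hx
    refine HasDerivAt.add ?_ ?_
    · refine HasDerivAt.fun_sum fun i _ => ?_
      have h := (hasDerivAt_pow (i + 1) x).const_mul (r i / ((i:ℝ) + 1))
      refine h.congr_deriv ?_
      have hi : ((i:ℝ) + 1) ≠ 0 := by positivity
      simp only [Nat.add_sub_cancel]
      push_cast
      field_simp
    · refine HasDerivAt.fun_sum fun k _ => HasDerivAt.fun_sum fun j _ => ?_
      exact hasDerivAt_re_const_mul_inv_pow (hxαk k x hx) _
  refine ⟨ρ, A, fun k => (αk k)⁻¹.re, fun k => (αk k)⁻¹.im, fun k => (d k).re, fun k => (d k).im,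
    ?_, ?_, fun k => (isAlgebraic_re_im (hαkalg k).inv).1,
    fun k => (isAlgebraic_re_im (hαkalg k).inv).2,
    fun k => (isAlgebraic_re_im (hdalg k)).1, fun k => (isAlgebraic_re_im (hdalg k)).2, ?_, ?_⟩
  · -- `ρ` is semialgebraic
    have hpow : ∀ i : ℕ, IsSemialgebraicFunOn ℚ {t : Fin 1 → ℝ | t 0 ∈ Ioo a b}
        (fun t => t 0 ^ i) := by
      intro i
      simpa using isSemialgebraicFunOn_aeval hI (MvPolynomial.X 0 ^ i : MvPolynomial (Fin 1) ℚ)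
    refine IsSemialgebraicFunOn.fun_add ?_ ?_
    · refine IsSemialgebraicFunOn.fun_finsetSum _ hI fun i _ => ?_
      refine (isSemialgebraicFunOn_const_of_isAlgebraic hI ?_).fun_mul (hpow (i + 1))
      simp only [div_eq_mul_inv]
      refine (hralg i).mul ?_
      simpa using isAlgebraic_algebraMap (R := ℚ) (A := ℝ) (((i:ℚ) + 1)⁻¹)
    · refine IsSemialgebraicFunOn.fun_finsetSum _ hI fun k _ =>
        IsSemialgebraicFunOn.fun_finsetSum _ hI fun j _ => ?_
      exact (isSemialgebraicFunOn_re_im_const_mul_inv_pow hI (hαkalg k) (hκalg k j) _).1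
  · -- `ρ` is analytic
    intro x hx
    refine AnalyticAt.add ?_ ?_
    · exact Finset.analyticAt_fun_sum _ fun i _ => analyticAt_const.mul (analyticAt_id.pow _)
    · exact Finset.analyticAt_fun_sum _ fun k _ => Finset.analyticAt_fun_sum _ fun j _ =>
        analyticAt_re_const_mul_inv_pow (hxαk k x hx)
  · -- slit condition
    intro k x hx
    exact slit_of_inv_pole ha hb (hαk0 k) (fun y hy => hxαk k y hy) hx
  · -- the identity
    intro x hx
    rw [(hρd x hx).deriv]
    -- the simple pole terms
    have hS : ∀ k, (d k / ((x : ℂ) - αk k)).re =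
        ((d k).re * (-(αk k)⁻¹.re + ((αk k)⁻¹.re ^ 2 + (αk k)⁻¹.im ^ 2) * x) +
          (d k).im * (αk k)⁻¹.im) /
          ((1 - (αk k)⁻¹.re * x) ^ 2 + ((αk k)⁻¹.im * x) ^ 2) := fun k =>
      re_div_sub_eq_residue_term (hαk0 k)
        (slit_of_inv_pole ha hb (hαk0 k) (fun y hy => hxαk k y hy) hx)
    simp_rw [← hS]
    -- the higher pole terms: `−m κ_{k,j} = φ(c_{k,j})/lc`
    have hH : ∀ k, ∀ j ∈ Finset.range (N k - 1),
        (-((N k - 1 - j : ℕ) : ℂ) * κ k j * ((((x : ℂ) - αk k) ^ (N k - 1 - j + 1)))⁻¹) =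
          φ (c (e k) j) / ((x : ℂ) - αk k) ^ (N k - j) / ((Q.leadingCoeff : ℚ) : ℂ) := by
      intro k j hj
      have hj' : j < N k - 1 := Finset.mem_range.mp hj
      have hm0 : ((N k - 1 - j : ℕ) : ℂ) ≠ 0 := by
        exact_mod_cast (Nat.sub_pos_of_lt hj').ne'
      have hexp : N k - 1 - j + 1 = N k - j := by omega
      rw [hexp, hκ]
      have hxk := pow_sub_ne_zero (hxαk k x hx) (N k - j)
      field_simp
    -- left-hand side through the partial fraction decomposition
    have hreal : (Polynomial.aeval x P / Polynomial.aeval x Q : ℝ) =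
        (((PL.map φ).eval (x : ℂ)) / ((QL.map φ).eval (x : ℂ))).re := by
      rw [heval, heval, ← Complex.ofReal_div, Complex.ofReal_re]
    rw [hreal, hpf (x : ℂ) (hQx x hx), hlc]
    -- real part of a quotient by the (rational) leading coefficient
    have hlcR : ((Q.leadingCoeff : ℚ) : ℂ) = (((Q.leadingCoeff : ℚ) : ℝ) : ℂ) := by
      rw [Complex.ofReal_ratCast]
    rw [add_div, Finset.sum_div, Complex.add_re, Complex.re_sum]
    -- polynomial part
    have hpoly : ((quo.map φ).eval (x : ℂ) / ((Q.leadingCoeff : ℚ) : ℂ)).re =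
        ∑ i ∈ Finset.range M, r i * x ^ i := by
      rw [hlcR, Complex.div_ofReal_re, re_eval_ofReal, Finset.sum_div,
        natDegree_map_eq_of_injective φ.injective]
      refine Finset.sum_congr rfl fun i _ => ?_
      rw [coeff_map, hr]
      ring
    rw [hpoly, add_assoc, ← Finset.sum_add_distrib]
    congr 1
    -- pole part: reindex `α ∈ s` by `k : Fin A` and split off the simple pole
    rw [← Finset.sum_coe_sort s, ← Equiv.sum_comp e]
    refine Finset.sum_congr rfl fun k _ => ?_
    have hsplit : Finset.range (QL.rootMultiplicity (e k : algebraicClosure ℚ ℂ)) =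
        Finset.range (N k - 1 + 1) := by
      rw [Nat.sub_add_cancel (hNpos k)]
    rw [Finset.sum_div, Complex.re_sum, hsplit, Finset.sum_range_succ]
    congr 1
    · refine Finset.sum_congr rfl fun j hj => ?_
      rw [hH k j hj]
    · -- the simple pole
      have hN1 : QL.rootMultiplicity (e k : algebraicClosure ℚ ℂ) - (N k - 1) = 1 := by
        show N k - (N k - 1) = 1
        have := hNpos k
        omega
      rw [hN1, pow_one]
      simp only [hd, hαk, hN, hn]
      rw [div_right_comm]

/-- **Complex-sector representation of rational one-variable KZ combinations.** For rational
functions `P_i/Q_i ∈ ℚ(x)` with `Q_i` non-vanishing on `(a,b) ⊇ [0,1]` (`a < 0`, `1 < b` rational)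
and integers `m₀, m_i`, the dilation function `ϖ ↦ m₀ + Σ m_i ∫_{[0,1]} P_i(ϖz)/Q_i(ϖz) dz` is, on
`[0,1]`, the dilation function of ONE integrand in Baker normal form
(`exists_bakerNormalForm` applied to the common-denominator fraction
`(m₀ Π Q_j + Σ m_i P_i Π_{j≠i} Q_j)/(Π Q_j)`). This is the representation hypothesis under which the
complex Baker sector `KZ.dilationBakerSectorComplex_lift` settles the dilation lifting problem at
`1` for one-variable rational data. [folklore] -/
theorem exists_complexSector_repr_rational (S : ℕ) (P Q : Fin S → ℚ[X]) (a b : ℚ)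
    (ha : (a:ℝ) < 0) (hb : 1 < (b:ℝ))
    (hQ : ∀ i, ∀ x ∈ Ioo (a:ℝ) b, Polynomial.aeval x (Q i) ≠ 0) (m : Fin S → ℤ) (m₀ : ℤ) :
    ∃ (ρ : ℝ → ℝ) (A : ℕ) (p q γ δ : Fin A → ℝ),
      IsSemialgebraicFunOn ℚ {t : Fin 1 → ℝ | t 0 ∈ Ioo (a:ℝ) b} (fun t => ρ (t 0)) ∧
      (∀ x ∈ Ioo (a:ℝ) b, AnalyticAt ℝ ρ x) ∧
      (∀ k, IsAlgebraic ℚ (p k)) ∧ (∀ k, IsAlgebraic ℚ (q k)) ∧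
      (∀ k, IsAlgebraic ℚ (γ k)) ∧ (∀ k, IsAlgebraic ℚ (δ k)) ∧
      (∀ k, ∀ x ∈ Ioo (a:ℝ) b, 0 < 1 - p k * x ∨ q k * x ≠ 0) ∧
      ∀ ϖ ∈ Icc (0:ℝ) 1, (m₀ : ℝ) + ∑ i, (m i : ℝ) *
          (∫ z in Set.pi Set.univ (fun _ : Fin 1 => Icc (0:ℝ) 1),
            Polynomial.aeval ((ϖ • z) 0) (P i) / Polynomial.aeval ((ϖ • z) 0) (Q i)) =
        ∫ z in Set.pi Set.univ (fun _ : Fin 1 => Icc (0:ℝ) 1),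
          (deriv ρ ((ϖ • z) 0) + ∑ k, (γ k * (-p k + (p k ^ 2 + q k ^ 2) * ((ϖ • z) 0)) +
            δ k * q k) / ((1 - p k * ((ϖ • z) 0)) ^ 2 + (q k * ((ϖ • z) 0)) ^ 2)) := by
  classical
  -- common denominator
  set Qt : ℚ[X] := ∏ i, Q i with hQt
  set Pt : ℚ[X] := Polynomial.C (m₀ : ℚ) * Qt +
    ∑ i, Polynomial.C (m i : ℚ) * P i * ∏ j ∈ Finset.univ.erase i, Q j with hPt
  have hQtx : ∀ x ∈ Ioo (a:ℝ) b, Polynomial.aeval x Qt ≠ 0 := by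
    intro x hx
    rw [hQt, map_prod]
    exact Finset.prod_ne_zero_iff.mpr fun i _ => hQ i x hx
  have hfrac : ∀ x ∈ Ioo (a:ℝ) b, Polynomial.aeval x Pt / Polynomial.aeval x Qt =
      (m₀ : ℝ) + ∑ i, (m i : ℝ) * (Polynomial.aeval x (P i) / Polynomial.aeval x (Q i)) := by
    intro x hx
    rw [div_eq_iff (hQtx x hx), add_mul, Finset.sum_mul, hPt, map_add, map_sum, map_mul,
      Polynomial.aeval_C, eq_ratCast, Rat.cast_intCast]
    congr 1
    refine Finset.sum_congr rfl fun i _ => ?_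
    have hQi : Polynomial.aeval x (Q i) ≠ 0 := hQ i x hx
    have hprod : Polynomial.aeval x Qt =
        Polynomial.aeval x (Q i) * ∏ j ∈ Finset.univ.erase i, Polynomial.aeval x (Q j) := by
      rw [hQt, map_prod, ← Finset.mul_prod_erase _ _ (Finset.mem_univ i)]
    rw [map_mul, map_mul, Polynomial.aeval_C, eq_ratCast, Rat.cast_intCast, map_prod, hprod]
    field_simp
  -- Baker normal form of the common-denominator fraction
  obtain ⟨ρ, A, p, q, γ, δ, hρs, hρa, hp, hq, hγ, hδ, hslit, hid⟩ :=
    exists_bakerNormalForm Pt Qt ha (zero_lt_one.trans hb) (KZ.BallPeeling.isSemialgebraic_Ioo₁ a b)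
      hQtx
  refine ⟨ρ, A, p, q, γ, δ, hρs, hρa, hp, hq, hγ, hδ, hslit, fun ϖ hϖ => ?_⟩
  -- points of the dilated cube lie in `[0,1] ⊆ (a,b)`
  have hmem : ∀ z ∈ Set.pi Set.univ (fun _ : Fin 1 => Icc (0:ℝ) 1), (ϖ • z) 0 ∈ Ioo (a:ℝ) b := by
    intro z hz
    have hz0 : z 0 ∈ Icc (0:ℝ) 1 := (Set.mem_univ_pi.mp hz) 0
    simp only [Pi.smul_apply, smul_eq_mul]
    exact ⟨lt_of_lt_of_le ha (mul_nonneg hϖ.1 hz0.1),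
      lt_of_le_of_lt (mul_le_one₀ hϖ.2 hz0.1 hz0.2) hb⟩
  -- the right-hand integrand on the cube is `m₀ + Σ m_i P_i/Q_i` at the dilated point
  have hcongr : (∫ z in Set.pi Set.univ (fun _ : Fin 1 => Icc (0:ℝ) 1),
      (deriv ρ ((ϖ • z) 0) + ∑ k, (γ k * (-p k + (p k ^ 2 + q k ^ 2) * ((ϖ • z) 0)) +
        δ k * q k) / ((1 - p k * ((ϖ • z) 0)) ^ 2 + (q k * ((ϖ • z) 0)) ^ 2))) =
      ∫ z in Set.pi Set.univ (fun _ : Fin 1 => Icc (0:ℝ) 1), ((m₀ : ℝ) + ∑ i, (m i : ℝ) *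
        (Polynomial.aeval ((ϖ • z) 0) (P i) / Polynomial.aeval ((ϖ • z) 0) (Q i))) := by
    refine MeasureTheory.setIntegral_congr_fun (MeasurableSet.univ_pi fun _ => measurableSet_Icc)
      fun z hz => ?_
    rw [← hid _ (hmem z hz), hfrac _ (hmem z hz)]
  -- integrability of the summands
  have hint : ∀ i, MeasureTheory.IntegrableOn (fun z : Fin 1 → ℝ =>
      Polynomial.aeval ((ϖ • z) 0) (P i) / Polynomial.aeval ((ϖ • z) 0) (Q i))
      (Set.pi Set.univ (fun _ : Fin 1 => Icc (0:ℝ) 1)) MeasureTheory.volume := by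
    intro i
    refine KZ.DilationLogSector.integrableOn_dilate_one ha hb
      (F := fun x => Polynomial.aeval x (P i) / Polynomial.aeval x (Q i)) ?_ hϖ
    exact (Polynomial.continuous_aeval _).continuousOn.div
      (Polynomial.continuous_aeval _).continuousOn fun x hx => hQ i x hx
  have hconst : MeasureTheory.IntegrableOn (fun _ : Fin 1 → ℝ => (m₀ : ℝ))
      (Set.pi Set.univ (fun _ : Fin 1 => Icc (0:ℝ) 1)) MeasureTheory.volume :=
    continuousOn_const.integrableOn_compact (isCompact_univ_pi fun _ => isCompact_Icc)
  have hsumint : MeasureTheory.IntegrableOn (fun z : Fin 1 → ℝ => ∑ i, (m i : ℝ) *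
      (Polynomial.aeval ((ϖ • z) 0) (P i) / Polynomial.aeval ((ϖ • z) 0) (Q i)))
      (Set.pi Set.univ (fun _ : Fin 1 => Icc (0:ℝ) 1)) MeasureTheory.volume :=
    MeasureTheory.integrable_finsetSum _ fun i _ => (hint i).const_mul _
  rw [hcongr, MeasureTheory.integral_add hconst hsumint,
    KZ.DilationLogSector.setIntegral_cube_one_const,
    MeasureTheory.integral_finsetSum _ fun i _ => (hint i).const_mul _]
  simp_rw [MeasureTheory.integral_const_mul]

end KZ.BakerSectorComplex

end Literature.NumberTheory.Transcendental
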